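import Literature.MathematicalPhysics.QuantumFieldTheory.Balaban1983to89.B9SectEKernel
import Literature.MathematicalPhysics.QuantumFieldTheory.Balaban1983to89.B9Thm315Decay
import Literature.MathematicalPhysics.QuantumFieldTheory.Balaban1983to89.B1Eq324BenfattoClassTorusWindowCovariance
import Literature.MathematicalPhysics.QuantumFieldTheory.Balaban1983to89.B1Eq324BenfattoKernelEq324AnyGammaUnitRange
import Literature.MathematicalPhysics.QuantumFieldTheory.GaussianToolkit
import HarnessLib

/-!
# `Balaban1983to89.B1Eq324BenfattoClassSectEMember` — THE SECT. E FLUCTUATION PRECISION `C*Δ_kC` OF [Balaban1985BackgroundPropagators]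
# (3.156)–(3.158) AND ITS INVERSE `C̃^{(k)}(Λ) = C^{(k)}(Λ)↾Λ̃` AS MEMBERS OF THE CLASS — matrix skeleton over finite real index sets with an
# abstract pseudo-distance, and [Balaban1982Higgs1] (3.24) for the Gaussian field of such a member on a labelled TORUS block, in both currencies,
# at every coupling `η ∈ (0,1]` (seat dag-n08-b gen 15; composes the pub-balaban Sect. E skeleton `B9SectEKernel`/`B6FromB4` with the n08 class road)

statement-level companion of a published source with citation tags; every declaration here is a theorem; nothing here is
a claim about the Yang–Mills mass gap

THE PRINTED LOCUS.  [Balaban1985BackgroundPropagators] (= [B9]) Sect. E p. 428: *"⟨B,(QG₁Q*)^{−1}B⟩ − a⟨B,B⟩ − 2⟨H₁D̃^{(2)}(B), J⟩ = ⟨B, Δ_kB⟩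
(3.156). This form is considered on the subspace … B = CB̃ … C^{(k)}(Λ) = C(C*Δ_kC)^{−1}C*, or (C*Δ_kC)^{−1} = C̃^{(k)}(Λ) = C^{(k)}(Λ)↾_Λ̃ (3.158)
… It is more convenient to work with the operator C̃^{(k)}(Λ), because it is defined by a positive definite operator C*Δ_kC with a lower bound
γ₀ > 0 independent of k and U. … Localizing the operators in Δ_k and using the methods of Sect. B we can prove it for C*Δ_kC with an arbitrary
configuration U … These facts together with a uniform exponential decay of C*Δ_kC implies bounds and uniform exponential decay for C^{(k)}(Λ)"*
(GAPS G-B9-09: the lower bound `γ₀` is asserted, proved nowhere in print); p. 422 (3.132): *"|(QGQ*)^{−1}(y, y′)| ≤ O(1)…e^{−δ₁d(y,y′)} … and the same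
for the operator with G₁"*; Theorem 3.15 p. 432 (3.187): *"|C^{(k)}(Λ; y, y′)| ≤ B₀e^{−δ₀|y−y′|}"*.  [Balaban1984PropagatorsII] p. 250: *"C is a
short-ranged operator, so C*Δ_kC has the same exponential decay as Δ_k"*.  [Balaban1985UV3] (= [B10]) p. 271: *"we obtain the Gaussian integral
determined by the positive quadratic form ⟨A, C*Δ_kCA⟩ … The number γ₁ is an upper bound of the positive, bounded operator C*Δ_kC"*; p. 261: the
cluster expansion of (22)–(25) is taken *"with respect to the Gaussian measure dμ_{C^{(0)}} … a covariance having an exponential decay property"*,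
and (24) p. 262 cites [Balaban1982Higgs1] (3.24) for its cumulant remainder (node N08's row `h324c`).

WHY THIS MODULE (cell `pub-ymgap`, seat `dag-n08-b` gen 15, CLAIM-1; node N08 [Balaban1985UV3]).  After gen 14 the class road delivers (3.24) for the
Gaussian field of EVERY class member in four currencies (`N08-CLASS-TOOLKIT.md` §7), and what is left for row `h324c` is the IDENT at [B10]'s
objects; its member half is *«N06's `γ₀` + decay of [B10]'s fluctuation precision»* (seat n08-d's located memo `N08-CLASS-ENTRY-LOCATED-g14.md` §2 (b),
seat n08-w4's `N08-ALPHA-ROW-RESIDUAL-g5.md` §2 (b)).  This file is the MATRIX SKELETON of that half, in the currency of the pub-balaban Sect. E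
skeleton (`B9SectEKernel`, `QGQInverse`, `B6FromB4`: finite real index sets, an abstract pseudo-distance `IsPseudoDist`): it turns the Sect.-E-shaped
inputs — the (3.132)-type decay of `P = (QG₁Q*)⁻¹`, the decay of the J-term, the locality of the elimination operator `C`, and the displayed lower
bound `γ₀` (resp., covariance side, `γ₀ ≤ C*Δ_kC ≤ γ₁` and the (3.187)-type decay of `(C*Δ_kC)⁻¹`) — into the member rows of the class theorems, and
composes the (3.24) capstones on a labelled torus block BY NAME (`…ClassTorusWindow.exists_presentation_of_torusDecay` ∘
`…KernelEq324AnyGammaUnitRange.eq324_kernel_of_expDecay_on_unit`, resp. `…ClassTorusWindowCovariance.exists_presentation_of_torusCovarianceDecay` ∘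
seat n08-w5's `…ClassEntryFromCovarianceUniform.eq324_covariance_of_expDecay_on_unit`), with the class scalars quantified FIRST and the index types
INSIDE, so that ONE threshold window `b₁` and ONE constant `C` serve every step `k`, every region and every background at fixed scalars.

WHAT IS PROVED (standard axioms; no `sorry`; no definition).
* §1 precision side — `abs_deltaK_le` (`Δ_k := P − a·1 − 𝒥` decays like `(K_P + |a| + K_𝒥)e^{−δρ}`), ★★ `abs_sandwich_le` (`|(CᵀΔC)(b,b′)| ≤
  K_Δe^{2δr}m_C²·e^{−δρ(ιb, ιb′)}` for a local `C`, over `B6FromB4.sandwich_decay` in the pseudo-metric space `B9Thm315Decay.pms ρ`), `sandwich_symm`,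
  ★ `sandwich_coercive_sum` (`B9SectEKernel.coercive_sandwich_of_range` read in the class binder shape), ★ `form_le_of_abs_le_exp` (an upper form bound
  `K·V` from entrywise decay, by the Schur test `QGQInverse.form_abs_le_of_schur` and a displayed lattice-sum constant `V`).
* §2 covariance side — ★★ `inv_rows_of_precision_bounds` (`T` symmetric, `γ₀ ≤ T ≤ γ₁` ⇒ `T⁻¹` symmetric, `(1/γ₁)`-coercive, `(1/γ₀)`-form-bounded;
  over `…ClassAppendixC.coercive_inv_of_form_le` and `GaussianToolkit.inv_form_bounds`).
* §3 capstones on a labelled torus block (variables `β`, `site : β → (ℤ/N)^d`, `lab : β → Fin m`, jointly injective), all at EVERY `η ∈ (0,1]`: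
  ★★★ `eq324_torus_of_expDecay_on_unit` (precision currency one-stop), ★★★ `eq324_sectEPrecision_torus_on_unit` (§1's inputs ⇒ (3.24) for
  `μ_{(Cᵀ(P − a·1 − 𝒥)C)⁻¹}`), ★★★ `eq324_torusCovariance_of_expDecay_on_unit` (covariance currency one-stop), ★★★ `eq324_sectECovariance_torus_on_unit`
  (`γ₀ ≤ T ≤ γ₁` + decay of `T⁻¹` ⇒ (3.24) for `μ_{T⁻¹}`).
* §4 ★★★ `eq324_sectEPrecision_torus_of_gamma0Assembly_on_unit` — §3's precision capstone with the `γ₀`-coercivity DERIVED from the interface of cell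
  pub-balaban's written γ₀-assembly (`B9SectEKernel.gamma0_assembly`: `QH = 1`, `(K + aQᵀQ)H = QᵀP`, (h1) covariant Stokes, (h2) Lemma 2.4′ on the
  admissible subspace, (hJ); the elimination matrix maps into the admissible subspace without decreasing norms), `γ₀ ≤ (c₂ − κ₂)/κ₁ − θ`.
* Two `example`s instantiate the scalar side of the Sect.-E capstones (non-vacuity of the binder lists).
HONEST SCOPE.  Count-neutral matrix bookkeeping composing LANDED theorems of this cell and of cell pub-balaban BY NAME; the inputs are DISPLAYED, not
proved: the (3.132)-type decay of `(QG₁Q*)⁻¹` and of the J-term, the locality of `C`, the lower bound `γ₀` (G-B9-09 — asserted, not proved, in print; in §4 its analytic inputs (h1), (h2), (hJ) instead),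
resp. `γ₁` and the (3.187)-type decay — they are node N06's ([B9]) content; the junction to the cell's Sect. E letters of record (def-Y's
`Node00.OpsYSectE.CsDeltaCY`/`deltaKY` over `Module.End ℂ`, `𝔸`-valued) is THE IDENT and is NOT made, NOT commissioned, NOT claimed; the Hamiltonian
letters of the (α)-socket (class II) are untouched; nothing of [Balaban1985UV3], [Balaban1984UV2], [BenfattoEtAl1978] or [Balaban1985BackgroundPropagators]
is asserted or discharged; node N08 is NOT discharged; nothing about d = 4, the continuum, OS axioms, a mass gap or the Clay problem.
-/

noncomputable section

open MeasureTheory Finset Matrix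

namespace Literature.MathematicalPhysics.QuantumFieldTheory.Balaban1983to89.B1Eq324BenfattoClassSectEMember

open Literature.MathematicalPhysics.QuantumFieldTheory
open Literature.MathematicalPhysics.QuantumFieldTheory.Balaban1983to89.B1Eq324BenfattoLemma
open Literature.MathematicalPhysics.QuantumFieldTheory.Balaban1983to89.B4Sect5Torus (IsPseudoDist)
open Literature.MathematicalPhysics.QuantumFieldTheory.Balaban1983to89.B1Eq324BenfattoClassAppendixC (posDef_of_coercive coercive_inv_of_form_le)
open Literature.MathematicalPhysics.QuantumFieldTheory.Balaban1983to89.B1Eq324BenfattoClassTorusWindow (exists_presentation_of_torusDecay)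
open Literature.MathematicalPhysics.QuantumFieldTheory.Balaban1983to89.B1Eq324BenfattoClassTorusWindowCovariance
  (exists_presentation_of_torusCovarianceDecay)
open Literature.MathematicalPhysics.QuantumFieldTheory.Balaban1983to89.B1Eq324BenfattoKernelEq324AnyGammaUnitRange (eq324_kernel_of_expDecay_on_unit)
open Literature.MathematicalPhysics.QuantumFieldTheory.Balaban1983to89.B1Eq324BenfattoClassEntryFromCovarianceUniform
  (eq324_covariance_of_expDecay_on_unit)

variable {d : ℕ}

/-! ## §0  Two binder-shape identities (private plumbing) -/

section Plumbing

variable {β : Type*} [Fintype β]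

/-- kernel: the `dotProduct` form of a matrix is the class files' `ΣΣ` form. [folklore] -/
private theorem dot_mulVec_eq_sum (T : Matrix β β ℝ) (x : β → ℝ) :
    x ⬝ᵥ (T *ᵥ x) = ∑ b, ∑ b', T b b' * x b * x b' := by
  simp only [dotProduct, Matrix.mulVec, Finset.mul_sum]
  exact Finset.sum_congr rfl fun b _ => Finset.sum_congr rfl fun b' _ => by ring

/-- kernel: `⟨x, x⟩ = Σ_b x_b²`. [folklore] -/
private theorem dot_self_eq_sum (x : β → ℝ) : x ⬝ᵥ x = ∑ b, x b ^ 2 := by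
  simp only [dotProduct]
  exact Finset.sum_congr rfl fun b _ => by ring

end Plumbing

/-! ## §1  Precision side: `T = Cᵀ(P − a·1 − 𝒥)C` — decay, symmetry, coercivity door, upper form bound -/

section Precision

/-- **`Δ_k = (QG₁Q*)⁻¹ − a − 𝒥` DECAYS** when its two kernels do: for a pseudo-distance with `ρ u u = 0`, `|P u v| ≤ K_P e^{−δρ(u,v)}` and
`|𝒥 u v| ≤ K_𝒥 e^{−δρ(u,v)}` give `|(P − a·1 − 𝒥) u v| ≤ (K_P + |a| + K_𝒥)·e^{−δρ(u,v)}` (the diagonal `a·1` costs `|a|` at distance `0`).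
[cite: Balaban1985BackgroundPropagators, (3.156) p.428, (3.132) p.422 («and the same for the operator with G₁»)] -/
theorem abs_deltaK_le {υ : Type*} [DecidableEq υ] {P J : Matrix υ υ ℝ} (a : ℝ) {ρ : υ → υ → ℝ} (hρ0 : ∀ u, ρ u u = 0) {KP KJ δ : ℝ}
    (hP : ∀ u v, |P u v| ≤ KP * Real.exp (-(δ * ρ u v))) (hJ : ∀ u v, |J u v| ≤ KJ * Real.exp (-(δ * ρ u v))) :
    ∀ u v, |(P - a • (1 : Matrix υ υ ℝ) - J) u v| ≤ (KP + |a| + KJ) * Real.exp (-(δ * ρ u v)) := by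
  intro u v
  have h1 : |(a • (1 : Matrix υ υ ℝ)) u v| ≤ |a| * Real.exp (-(δ * ρ u v)) := by
    by_cases huv : u = v
    · subst huv
      simp [hρ0]
    · have h0 : (a • (1 : Matrix υ υ ℝ)) u v = 0 := by simp [Matrix.one_apply_ne huv]
      rw [h0, abs_zero]
      positivity
  have h2 : |(P - a • (1 : Matrix υ υ ℝ) - J) u v| ≤ |P u v| + |(a • (1 : Matrix υ υ ℝ)) u v| + |J u v| := by
    simp only [Matrix.sub_apply]
    have e1 := abs_sub (P u v - (a • (1 : Matrix υ υ ℝ)) u v) (J u v)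
    have e2 := abs_sub (P u v) ((a • (1 : Matrix υ υ ℝ)) u v)
    linarith
  calc |(P - a • (1 : Matrix υ υ ℝ) - J) u v| ≤ |P u v| + |(a • (1 : Matrix υ υ ℝ)) u v| + |J u v| := h2
    _ ≤ KP * Real.exp (-(δ * ρ u v)) + |a| * Real.exp (-(δ * ρ u v)) + KJ * Real.exp (-(δ * ρ u v)) :=
        add_le_add (add_le_add (hP u v) h1) (hJ u v)
    _ = (KP + |a| + KJ) * Real.exp (-(δ * ρ u v)) := by ring

/-- ★★ **«C IS A SHORT-RANGED OPERATOR, SO C*Δ_kC HAS THE SAME EXPONENTIAL DECAY AS Δ_k»** — matrix form with its constant.  Variables `υ` of `Δ_k`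
carry a pseudo-distance `ρ`; the free variables `β` (`B = CB̃`, (3.158)) sit at positions `ι : β → υ`; the elimination matrix `C : Matrix υ β ℝ` is
LOCAL (`C u b ≠ 0 ⇒ ρ(u, ιb) ≤ r`) with column `ℓ¹`-mass `≤ m_C`; `|D u v| ≤ K_D e^{−δρ(u,v)}`.  THEN `|(CᵀDC)(b, b′)| ≤ K_De^{2δr}m_C²·e^{−δρ(ιb, ιb′)}`
— cell pub-balaban's `B6FromB4.sandwich_decay` in the pseudo-metric space `B9Thm315Decay.pms ρ` (nothing restated).
[cite: Balaban1984PropagatorsII, p.250; Balaban1985BackgroundPropagators, (3.157)–(3.158) p.428] -/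
theorem abs_sandwich_le {υ β : Type} [Fintype υ] (ρ : υ → υ → ℝ) (hρ : IsPseudoDist ρ) (ι : β → υ) (C : Matrix υ β ℝ) (D : Matrix υ υ ℝ)
    {KD δ r mC : ℝ} (hKD : 0 ≤ KD) (hδ : 0 ≤ δ)
    (hD : ∀ u v, |D u v| ≤ KD * Real.exp (-(δ * ρ u v)))
    (hCr : ∀ u b, C u b ≠ 0 → ρ u (ι b) ≤ r) (hC1 : ∀ b, ∑ u, |C u b| ≤ mC) :
    ∀ b b', |(Cᵀ * D * C) b b'| ≤ KD * Real.exp (2 * δ * r) * mC * mC * Real.exp (-(δ * ρ (ι b) (ι b'))) := by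
  letI : PseudoMetricSpace υ := B9Thm315Decay.pms ρ hρ
  exact B6FromB4.sandwich_decay (X := υ) (fun u : υ => u) ι Cᵀ D C hKD hδ
    (fun b u h => by
      change ρ (ι b) u ≤ r
      rw [hρ.symm]
      exact hCr u b (by simpa [Matrix.transpose_apply] using h))
    (fun b => by simpa [Matrix.transpose_apply] using hC1 b)
    (fun v k h => hCr v k h) hC1 hD

/-- **`CᵀDC` IS SYMMETRIC** for symmetric `D` (the form ⟨A, C*Δ_kCA⟩ of [B10] p.271 is a symmetric form in the free variables) — cell
pub-balaban's `B6FromB4.sandwich_isSymm` read in the class files' entry shape (nothing restated).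
[cite: Balaban1985UV3, p.271; Balaban1985BackgroundPropagators, (3.158) p.428] -/
theorem sandwich_symm {υ β : Type} [Fintype υ] (C : Matrix υ β ℝ) {D : Matrix υ υ ℝ} (hD : ∀ u v, D u v = D v u) :
    ∀ b b', (Cᵀ * D * C) b b' = (Cᵀ * D * C) b' b :=
  fun b b' => (B6FromB4.sandwich_isSymm C (Matrix.IsSymm.ext fun u v => hD v u)).apply b' b

/-- ★ **THE `γ₀` DOOR** — cell pub-balaban's `B9SectEKernel.coercive_sandwich_of_range` (the passage «C maps into the admissible subspace and
`‖CB̃‖ ≥ ‖B̃‖`, `Δ_k ≥ γ₀` on that subspace ⇒ `C*Δ_kC ≥ γ₀`» of (3.157)–(3.158)) read in the class files' binder shape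
`∀ x, γ₀·Σ_b x_b² ≤ Σ_{b,b′}(CᵀDC)(b,b′)x_b x_{b′}`.  The subspace bound `γ₀` itself is G-B9-09 (asserted in print, not proved) — an INPUT here.
[cite: Balaban1985BackgroundPropagators, Sect. E p.428 («a positive definite operator C*Δ_kC with a lower bound γ₀ > 0 independent of k and U»)] -/
theorem sandwich_coercive_sum {υ β : Type*} [Fintype υ] [Fintype β] (D : Matrix υ υ ℝ) (C : Matrix υ β ℝ) (good : (υ → ℝ) → Prop) {γ : ℝ} (hγ : 0 ≤ γ)
    (hgood : ∀ v : β → ℝ, good (C *ᵥ v)) (hC : ∀ v : β → ℝ, v ⬝ᵥ v ≤ (C *ᵥ v) ⬝ᵥ (C *ᵥ v))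
    (hT : ∀ B : υ → ℝ, good B → γ * (B ⬝ᵥ B) ≤ B ⬝ᵥ (D *ᵥ B)) :
    ∀ x : β → ℝ, γ * ∑ b, x b ^ 2 ≤ ∑ b, ∑ b', (Cᵀ * D * C) b b' * x b * x b' := by
  intro x
  have h := B9SectEKernel.coercive_sandwich_of_range D C good hγ hgood hC hT x
  rwa [dot_self_eq_sum, dot_mulVec_eq_sum] at h

/-- ★ **AN UPPER FORM BOUND FROM ENTRYWISE DECAY** ([B10] p.271 «γ₁ is an upper bound of the positive, bounded operator C*Δ_kC»): if
`|T b b′| ≤ K e^{−κρ(b,b′)}` for a symmetric `ρ` and the lattice sums obey `Σ_{b′} e^{−κρ(b,b′)} ≤ V`, then `Σ_{b,b′} T(b,b′)x_b x_{b′} ≤ K·V·Σ_b x_b²`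
— the finite Schur test (cell pub-balaban's `QGQInverse.form_abs_le_of_schur` with row and column sums `K·V`).
[cite: Balaban1985UV3, p.271; HornJohnson2013, §5.6 (‖A‖₂² ≤ ‖A‖₁‖A‖_∞, Schur test)] -/
theorem form_le_of_abs_le_exp {β : Type*} [Fintype β] {T : Matrix β β ℝ} {ρ : β → β → ℝ} (hρs : ∀ b b', ρ b b' = ρ b' b) {K κ V : ℝ} (hK : 0 ≤ K) (hV : 0 ≤ V)
    (hT : ∀ b b', |T b b'| ≤ K * Real.exp (-(κ * ρ b b'))) (hVrow : ∀ b, ∑ b', Real.exp (-(κ * ρ b b')) ≤ V) :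
    ∀ x : β → ℝ, ∑ b, ∑ b', T b b' * x b * x b' ≤ K * V * ∑ b, x b ^ 2 := by
  intro x
  have hrow : ∀ b, ∑ b', |T b b'| ≤ K * V := fun b =>
    calc ∑ b', |T b b'| ≤ ∑ b', K * Real.exp (-(κ * ρ b b')) := Finset.sum_le_sum fun b' _ => hT b b'
      _ = K * ∑ b', Real.exp (-(κ * ρ b b')) := by rw [Finset.mul_sum]
      _ ≤ K * V := mul_le_mul_of_nonneg_left (hVrow b) hK
  have hcol : ∀ b', ∑ b, |T b b'| ≤ K * V := fun b' =>
    calc ∑ b, |T b b'| ≤ ∑ b, K * Real.exp (-(κ * ρ b b')) := Finset.sum_le_sum fun b _ => hT b b'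
      _ = K * ∑ b, Real.exp (-(κ * ρ b' b)) := by
          rw [Finset.mul_sum]
          exact Finset.sum_congr rfl fun b _ => by rw [hρs]
      _ ≤ K * V := mul_le_mul_of_nonneg_left (hVrow b') hK
  have h := QGQInverse.form_abs_le_of_schur T (ρ := K * V) (by positivity) (by rw [sq]) hrow hcol x
  rw [dot_mulVec_eq_sum, dot_self_eq_sum] at h
  exact (le_abs_self _).trans h

end Precision

/-! ## §2  Covariance side: the rows of `C̃^{(k)} = (C*Δ_kC)⁻¹` from `γ₀ ≤ C*Δ_kC ≤ γ₁` -/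

section Covariance

variable {β : Type*} [Fintype β] [DecidableEq β]

/-- ★★ **THE COVARIANCE ROWS FROM THE PRECISION BOUNDS** — for a symmetric `T` with `γ₀·‖x‖² ≤ ⟨x,Tx⟩ ≤ γ₁·‖x‖²` (`γ₀ > 0`): `T⁻¹` is symmetric,
`(1/γ₁)`-coercive and `(1/γ₀)`-form-bounded, in the class binder shapes — three of the four rows seat n08-w5's covariance door
`…ClassEntryFromCovarianceUniform.eq324_covariance_of_expDecay(_on_unit)` reads at `G := C̃^{(k)}(Λ) = (C*Δ_kC)⁻¹` ((3.158)); the fourth is the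
(3.187)-type decay.  (`…ClassAppendixC.coercive_inv_of_form_le` + `GaussianToolkit.inv_form_bounds`, nothing new.)
[cite: Balaban1985BackgroundPropagators, (3.157)–(3.158) p.428; Balaban1985UV3, p.271 («γ₁ is an upper bound of … C*Δ_kC»); HornJohnson2013, §7.7 (Loewner order reverses under inversion)] -/
theorem inv_rows_of_precision_bounds {T : Matrix β β ℝ} (hTs : ∀ b b', T b b' = T b' b) {γ₀ γ₁ : ℝ} (hγ₀ : 0 < γ₀)
    (hlow : ∀ x : β → ℝ, γ₀ * ∑ b, x b ^ 2 ≤ ∑ b, ∑ b', T b b' * x b * x b')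
    (hup : ∀ x : β → ℝ, ∑ b, ∑ b', T b b' * x b * x b' ≤ γ₁ * ∑ b, x b ^ 2) :
    (∀ b b', (T⁻¹ : Matrix β β ℝ) b b' = (T⁻¹ : Matrix β β ℝ) b' b) ∧
      (∀ x : β → ℝ, 1 / γ₁ * ∑ b, x b ^ 2 ≤ ∑ b, ∑ b', (T⁻¹ : Matrix β β ℝ) b b' * x b * x b') ∧
      (∀ x : β → ℝ, ∑ b, ∑ b', (T⁻¹ : Matrix β β ℝ) b b' * x b * x b' ≤ 1 / γ₀ * ∑ b, x b ^ 2) := by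
  have hPD : T.PosDef := posDef_of_coercive hTs hγ₀ hlow
  refine ⟨fun b b' => ?_, coercive_inv_of_form_le hTs hγ₀ hlow hup, fun x => ?_⟩
  · have h := hPD.inv.isHermitian.apply b b'
    simpa using h.symm
  · have hnorm : ∀ v : β → ℝ, ‖(WithLp.toLp 2 v : EuclideanSpace ℝ β)‖ ^ 2 = ∑ b, v b ^ 2 := fun v => by
      rw [EuclideanSpace.real_norm_sq_eq]
    have hlow' : ∀ v : β → ℝ, γ₀ * ‖(WithLp.toLp 2 v : EuclideanSpace ℝ β)‖ ^ 2 ≤ v ⬝ᵥ T *ᵥ v := fun v => by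
      rw [hnorm, dot_mulVec_eq_sum]
      exact hlow v
    have hup' : ∀ v : β → ℝ, v ⬝ᵥ T *ᵥ v ≤ γ₁ * ‖(WithLp.toLp 2 v : EuclideanSpace ℝ β)‖ ^ 2 := fun v => by
      rw [hnorm, dot_mulVec_eq_sum]
      exact hup v
    have h := (GaussianToolkit.inv_form_bounds hPD hγ₀ hlow' hup' x).2
    rw [hnorm, dot_mulVec_eq_sum] at h
    simpa [one_div] using h

end Covariance

/-! ## §3  [Balaban1982Higgs1] (3.24) for a Sect. E member on a labelled torus block, every `η ∈ (0,1]` -/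

section Torus

/-- ★★★ **(3.24) FOR A TORUS BLOCK GIVEN BY ITS PRECISION, AT EVERY COUPLING `η ∈ (0,1]` — ONE-STOP.**  For `d ≥ 1`, a label count `m`, class scalars
`γ > 0`, `K ≥ 0`, `κ_T > 0` and the (3.24) letters `t D`, `ϰ > 0`, `p₀ > 2/3`, `σ > 0`, `c ≥ 0`, `0 < κ < σ(t+1)`: there is a threshold window `b₁`
(scalars only) such that for every `b₀ > b₁` there is `C ≥ 0` with — for EVERY `η ∈ (0,1]`, EVERY torus size `N ≥ 1`, EVERY finite non-empty family
of variables `β` labelled injectively by `(site : β → (ℤ/N)^d, lab : β → Fin m)`, EVERY precision `T : Matrix β β ℝ` symmetric, `γ`-coercive, with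
`|T b b′| ≤ K e^{−κ_Tρ(b,b′)}` for a `ρ` dominating the torus sup-distance of the sites — a window `Λ ⊂ ℤ^{2d+1}` and `e : β ≃ ↥Λ` presenting
`𝒩(0, T⁻¹)` as the class field of the zero-extended `(reindex e e T)⁻¹` (Gaussian bridge + a.e. box identity), and for all `(s, I ⊇ J, a)` with
`I ≠ ∅`, `J ⊆ Λ`, `sup|a| ≤ c·η^σ` the (3.24) pair `0 < ∫Π_Δχ̂_{I,p(η)}e^{H_J}dμ_K`, `|log ∫ − Σ_{k≤t}𝓔^T(H_J;k)/k!| ≤ C·η^κ·|I|`.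
Proof: `…ClassTorusWindow.exists_presentation_of_torusDecay` ∘ `…KernelEq324AnyGammaUnitRange.eq324_kernel_of_expDecay_on_unit` on `ℤ^{2d+1}` at
`(γ, K e^{κ_T m}, κ_T/√(2d+1))` — the composition of `N08-CLASS-TOOLKIT.md` §7 row 4 as ONE theorem, all-η, with `β` quantified inside.
[cite: Balaban1982Higgs1, (3.24) p.616; BenfattoEtAl1978, Lemma (4.5)–(4.7) p.152; Balaban1985UV3, (22)–(24) p.261–262, (58) p.270 (the unit torus);
Balaban1985BackgroundPropagators, Sect. E p.428 (class form; the bent window is ours)] -/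
theorem eq324_torus_of_expDecay_on_unit (hd : 0 < d) (m : ℕ) {γ K κT : ℝ} (hγ0 : 0 < γ) (hK : 0 ≤ K) (hκT : 0 < κT)
    (t D : ℕ) {ϰ : ℝ} (hϰ : 0 < ϰ) {p₀ σ c κ : ℝ} (hp₀ : 2 / 3 < p₀) (hσ : 0 < σ) (hc : 0 ≤ c) (hκ : 0 < κ)
    (hκσ : κ < σ * (t + 1)) :
    ∃ b₁ : ℝ, ∀ b₀ : ℝ, b₁ < b₀ → ∃ C : ℝ, 0 ≤ C ∧ ∀ η : ℝ, 0 < η → η ≤ 1 →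
      ∀ {N : ℕ} [NeZero N] {β : Type} [Fintype β] [DecidableEq β] [Nonempty β]
        (site : β → Fin d → ZMod N) (lab : β → Fin m), (Function.Injective fun b => (site b, lab b)) →
      ∀ {T : Matrix β β ℝ} {ρ : β → β → ℝ}, (∀ b b', T b b' = T b' b) →
        (∀ v : β → ℝ, γ * ∑ b, v b ^ 2 ≤ ∑ b, ∑ b', T b b' * v b * v b') →
        (∀ b b', |T b b'| ≤ K * Real.exp (-(κT * ρ b b'))) →
        (∀ b b' i, (|((site b i - site b' i).valMinAbs : ℤ)| : ℝ) ≤ ρ b b') →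
      ∃ (Λ : Finset (B1Eq324BenfattoLemma.Site (d + d + 1))) (e : β ≃ ↥Λ),
        ((gaussianFieldOfKernel fun x y => if h : x ∈ Λ ∧ y ∈ Λ then ((Matrix.reindex e e T)⁻¹ : Matrix ↥Λ ↥Λ ℝ) ⟨x, h.1⟩ ⟨y, h.2⟩ else 0).map
            (fun (z : B1Eq324BenfattoLemma.Site (d + d + 1) → ℝ) (b : β) => z ((e b : ↥Λ) : B1Eq324BenfattoLemma.Site (d + d + 1))) =
          gaussianFieldOfKernel fun b b' => (T⁻¹ : Matrix β β ℝ) b b') ∧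
        (∀ p : ℝ, 0 ≤ p →
          ((fun (z : B1Eq324BenfattoLemma.Site (d + d + 1) → ℝ) (b : β) => z ((e b : ↥Λ) : B1Eq324BenfattoLemma.Site (d + d + 1))) ⁻¹'
              {ω : β → ℝ | ∀ b, |ω b| ≤ p}) =ᵐ[gaussianFieldOfKernel fun x y =>
                if h : x ∈ Λ ∧ y ∈ Λ then ((Matrix.reindex e e T)⁻¹ : Matrix ↥Λ ↥Λ ℝ) ⟨x, h.1⟩ ⟨y, h.2⟩ else 0] smallFieldSet Λ p) ∧
        ∀ (s : ℕ) (I J : Finset (B1Eq324BenfattoLemma.Site (d + d + 1))) (a : Coef (d + d + 1)), I.Nonempty → J ⊆ I → J ⊆ Λ →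
          coefSup s D a J ≤ c * η ^ σ →
          0 < ∫ z, cutoffBoltzmann (hamiltonian s D ϰ a J) I (B10.pFun b₀ p₀ η) z ∂(gaussianFieldOfKernel fun x y =>
              if h : x ∈ Λ ∧ y ∈ Λ then ((Matrix.reindex e e T)⁻¹ : Matrix ↥Λ ↥Λ ℝ) ⟨x, h.1⟩ ⟨y, h.2⟩ else 0) ∧
            |Real.log (∫ z, cutoffBoltzmann (hamiltonian s D ϰ a J) I (B10.pFun b₀ p₀ η) z ∂(gaussianFieldOfKernel fun x y =>
                if h : x ∈ Λ ∧ y ∈ Λ then ((Matrix.reindex e e T)⁻¹ : Matrix ↥Λ ↥Λ ℝ) ⟨x, h.1⟩ ⟨y, h.2⟩ else 0)) -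
              cumulantSum (gaussianFieldOfKernel fun x y =>
                if h : x ∈ Λ ∧ y ∈ Λ then ((Matrix.reindex e e T)⁻¹ : Matrix ↥Λ ↥Λ ℝ) ⟨x, h.1⟩ ⟨y, h.2⟩ else 0)
                (hamiltonian s D ϰ a J) t| ≤ C * η ^ κ * I.card := by
  have hd' : 0 < d + d + 1 := by omega
  have hKA : 0 ≤ K * Real.exp (κT * m) := by positivity
  have hκA : 0 < κT / Real.sqrt (d + d + 1) := div_pos hκT (Real.sqrt_pos.mpr (by positivity))
  obtain ⟨b₁, hb₁⟩ := eq324_kernel_of_expDecay_on_unit (d := d + d + 1) hd' hγ0 hKA hκA t D hϰ hp₀ hσ hc hκ hκσ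
  refine ⟨b₁, fun b₀ hb₀ => ?_⟩
  obtain ⟨C, hC, hE⟩ := hb₁ b₀ hb₀
  refine ⟨C, hC, fun η hη hηle N _ β _ _ _ site lab hinj T ρ hTs hγ hdec hρ => ?_⟩
  obtain ⟨Λ, e, hsymm, hcoer, hdec', hmap, hbox⟩ :=
    exists_presentation_of_torusDecay d N m hd site lab hinj hTs hγ0 hγ hK hκT.le hdec hρ
  refine ⟨Λ, e, hmap, hbox, fun s I J a hI hJI hJΛ hA => ?_⟩
  have hΛ : Λ.Nonempty := ⟨_, (e (Classical.arbitrary β)).2⟩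
  exact hE η hη hηle (fun x y => rfl) hΛ hsymm hcoer hdec' s I J a hI hJI hJΛ hA

/-- ★★★ **(3.24) FOR THE GAUSSIAN FIELD OF THE SECT. E PRECISION `C*Δ_kC` ON A TORUS BLOCK, AT EVERY COUPLING `η ∈ (0,1]`** — the matrix skeleton of
the member half of the IDENT for node N08's row `h324c`.  Class scalars FIRST: `d ≥ 1`, label count `m`, `γ₀ > 0` (the lower bound of `C*Δ_kC`,
G-B9-09), decay constants `K_P, K_𝒥 ≥ 0`, `a₀ ≥ 0`, rate `δ > 0`, locality radius `r` and column mass `m_C ≥ 0` of the elimination matrix, and the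
(3.24) letters.  THEN `∃ b₁ ∀ b₀ > b₁ ∃ C ≥ 0` such that for EVERY `η ∈ (0,1]`, torus size `N`, variables `υ` of `Δ_k` with a pseudo-distance `ρ`,
free variables `β ≠ ∅` (torus sites `site`, labels `lab`, jointly injective) placed at `ι : β → υ` with `ρ(ιb, ιb′) ≥` the torus sup-distance of
their sites, EVERY symmetric `P` ((3.132)-decaying), symmetric `𝒥` (decaying), `|a| ≤ a₀`, local elimination matrix `C` of (3.158) (binder `E`), such that `T := Cᵀ(P − a·1 − 𝒥)C` is
`γ₀`-coercive (DISPLAYED): a window `Λ ⊂ ℤ^{2d+1}`, `e : β ≃ ↥Λ` presenting `𝒩(0, T⁻¹) = dμ_{C̃^{(k)}}` as a class field, the a.e. box identity, and the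
(3.24) pair for all `(s, I ⊇ J, a)` with `sup|a| ≤ c·η^σ`.  Proof: §1 (`abs_deltaK_le`, `abs_sandwich_le`, `sandwich_symm`) ⇒ `eq324_torus_of_expDecay_on_unit`
at `K := (K_P + a₀ + K_𝒥)e^{2δr}m_C²`.
[cite: Balaban1985BackgroundPropagators, (3.132) p.422, (3.156)–(3.158) p.428; Balaban1984PropagatorsII, p.250; Balaban1985UV3, (24) p.262, (58) p.270,
p.271; Balaban1982Higgs1, (3.24) p.616; BenfattoEtAl1978, Lemma (4.5)–(4.7) p.152 (class form; ours)] -/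
theorem eq324_sectEPrecision_torus_on_unit (hd : 0 < d) (m : ℕ) {γ₀ KP KJ a₀ δ r mC : ℝ} (hγ₀ : 0 < γ₀) (hKP : 0 ≤ KP) (hKJ : 0 ≤ KJ)
    (ha₀ : 0 ≤ a₀) (hδ : 0 < δ) (hmC : 0 ≤ mC)
    (t D : ℕ) {ϰ : ℝ} (hϰ : 0 < ϰ) {p₀ σ c κ : ℝ} (hp₀ : 2 / 3 < p₀) (hσ : 0 < σ) (hc : 0 ≤ c) (hκ : 0 < κ)
    (hκσ : κ < σ * (t + 1)) :
    ∃ b₁ : ℝ, ∀ b₀ : ℝ, b₁ < b₀ → ∃ C : ℝ, 0 ≤ C ∧ ∀ η : ℝ, 0 < η → η ≤ 1 →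
      ∀ {N : ℕ} [NeZero N] {υ β : Type} [Fintype υ] [DecidableEq υ] [Fintype β] [DecidableEq β] [Nonempty β]
        (ρ : υ → υ → ℝ), IsPseudoDist ρ →
      ∀ (site : β → Fin d → ZMod N) (lab : β → Fin m), (Function.Injective fun b => (site b, lab b)) →
      ∀ (ι : β → υ), (∀ b b' i, (|((site b i - site b' i).valMinAbs : ℤ)| : ℝ) ≤ ρ (ι b) (ι b')) →
      ∀ {P J : Matrix υ υ ℝ} {a : ℝ} {E : Matrix υ β ℝ}, (∀ u v, P u v = P v u) → (∀ u v, J u v = J v u) →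
        (∀ u v, |P u v| ≤ KP * Real.exp (-(δ * ρ u v))) → (∀ u v, |J u v| ≤ KJ * Real.exp (-(δ * ρ u v))) → |a| ≤ a₀ →
        (∀ u b, E u b ≠ 0 → ρ u (ι b) ≤ r) → (∀ b, ∑ u, |E u b| ≤ mC) →
        (∀ v : β → ℝ, γ₀ * ∑ b, v b ^ 2 ≤ ∑ b, ∑ b', (Eᵀ * (P - a • (1 : Matrix υ υ ℝ) - J) * E) b b' * v b * v b') →
      ∃ (Λ : Finset (B1Eq324BenfattoLemma.Site (d + d + 1))) (e : β ≃ ↥Λ),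
        ((gaussianFieldOfKernel fun x y => if h : x ∈ Λ ∧ y ∈ Λ then
            ((Matrix.reindex e e (Eᵀ * (P - a • (1 : Matrix υ υ ℝ) - J) * E))⁻¹ : Matrix ↥Λ ↥Λ ℝ) ⟨x, h.1⟩ ⟨y, h.2⟩ else 0).map
            (fun (z : B1Eq324BenfattoLemma.Site (d + d + 1) → ℝ) (b : β) => z ((e b : ↥Λ) : B1Eq324BenfattoLemma.Site (d + d + 1))) =
          gaussianFieldOfKernel fun b b' => ((Eᵀ * (P - a • (1 : Matrix υ υ ℝ) - J) * E)⁻¹ : Matrix β β ℝ) b b') ∧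
        (∀ p : ℝ, 0 ≤ p →
          ((fun (z : B1Eq324BenfattoLemma.Site (d + d + 1) → ℝ) (b : β) => z ((e b : ↥Λ) : B1Eq324BenfattoLemma.Site (d + d + 1))) ⁻¹'
              {ω : β → ℝ | ∀ b, |ω b| ≤ p}) =ᵐ[gaussianFieldOfKernel fun x y => if h : x ∈ Λ ∧ y ∈ Λ then
                ((Matrix.reindex e e (Eᵀ * (P - a • (1 : Matrix υ υ ℝ) - J) * E))⁻¹ : Matrix ↥Λ ↥Λ ℝ) ⟨x, h.1⟩ ⟨y, h.2⟩ else 0]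
            smallFieldSet Λ p) ∧
        ∀ (s : ℕ) (I J' : Finset (B1Eq324BenfattoLemma.Site (d + d + 1))) (𝔞 : Coef (d + d + 1)), I.Nonempty → J' ⊆ I → J' ⊆ Λ →
          coefSup s D 𝔞 J' ≤ c * η ^ σ →
          0 < ∫ z, cutoffBoltzmann (hamiltonian s D ϰ 𝔞 J') I (B10.pFun b₀ p₀ η) z ∂(gaussianFieldOfKernel fun x y => if h : x ∈ Λ ∧ y ∈ Λ then
              ((Matrix.reindex e e (Eᵀ * (P - a • (1 : Matrix υ υ ℝ) - J) * E))⁻¹ : Matrix ↥Λ ↥Λ ℝ) ⟨x, h.1⟩ ⟨y, h.2⟩ else 0) ∧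
            |Real.log (∫ z, cutoffBoltzmann (hamiltonian s D ϰ 𝔞 J') I (B10.pFun b₀ p₀ η) z ∂(gaussianFieldOfKernel fun x y =>
                if h : x ∈ Λ ∧ y ∈ Λ then
                  ((Matrix.reindex e e (Eᵀ * (P - a • (1 : Matrix υ υ ℝ) - J) * E))⁻¹ : Matrix ↥Λ ↥Λ ℝ) ⟨x, h.1⟩ ⟨y, h.2⟩ else 0)) -
              cumulantSum (gaussianFieldOfKernel fun x y => if h : x ∈ Λ ∧ y ∈ Λ then
                  ((Matrix.reindex e e (Eᵀ * (P - a • (1 : Matrix υ υ ℝ) - J) * E))⁻¹ : Matrix ↥Λ ↥Λ ℝ) ⟨x, h.1⟩ ⟨y, h.2⟩ else 0)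
                (hamiltonian s D ϰ 𝔞 J') t| ≤ C * η ^ κ * I.card := by
  -- the class constant of the member, uniform in the data
  have hK : 0 ≤ (KP + a₀ + KJ) * Real.exp (2 * δ * r) * mC * mC := by positivity
  obtain ⟨b₁, hb₁⟩ := eq324_torus_of_expDecay_on_unit (d := d) hd m hγ₀ hK hδ t D hϰ hp₀ hσ hc hκ hκσ
  refine ⟨b₁, fun b₀ hb₀ => ?_⟩
  obtain ⟨C, hC, hE⟩ := hb₁ b₀ hb₀
  refine ⟨C, hC, fun η hη hηle N _ υ β _ _ _ _ _ ρ hρ site lab hinj ι hρι P J a E hPs hJs hP hJ ha hCr hC1 hγ => ?_⟩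
  -- §1: symmetry and decay of `T = Cᵀ(P − a·1 − 𝒥)C` along `ρ ∘ ι`
  have hDs : ∀ u v, (P - a • (1 : Matrix υ υ ℝ) - J) u v = (P - a • (1 : Matrix υ υ ℝ) - J) v u := by
    intro u v
    simp only [Matrix.sub_apply, Matrix.smul_apply, smul_eq_mul]
    rw [hPs u v, hJs u v, Matrix.one_apply, Matrix.one_apply]
    by_cases h : u = v
    · subst h; rfl
    · rw [if_neg h, if_neg (Ne.symm h)]
  have hTs := sandwich_symm E hDs
  have hD := abs_deltaK_le a hρ.zero hP hJ
  have hdec₀ := abs_sandwich_le ρ hρ ι E (P - a • (1 : Matrix υ υ ℝ) - J) (by positivity) hδ.le hD hCr hC1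
  have hdec : ∀ b b', |(Eᵀ * (P - a • (1 : Matrix υ υ ℝ) - J) * E) b b'| ≤
      (KP + a₀ + KJ) * Real.exp (2 * δ * r) * mC * mC * Real.exp (-(δ * ρ (ι b) (ι b'))) := by
    intro b b'
    refine (hdec₀ b b').trans (mul_le_mul_of_nonneg_right ?_ (Real.exp_pos _).le)
    have h1 : KP + |a| + KJ ≤ KP + a₀ + KJ := by linarith
    have h2 : 0 ≤ Real.exp (2 * δ * r) * mC * mC := by positivity
    calc (KP + |a| + KJ) * Real.exp (2 * δ * r) * mC * mC = (KP + |a| + KJ) * (Real.exp (2 * δ * r) * mC * mC) := by ring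
      _ ≤ (KP + a₀ + KJ) * (Real.exp (2 * δ * r) * mC * mC) := mul_le_mul_of_nonneg_right h1 h2
      _ = (KP + a₀ + KJ) * Real.exp (2 * δ * r) * mC * mC := by ring
  exact hE η hη hηle site lab hinj (ρ := fun b b' => ρ (ι b) (ι b')) hTs hγ hdec hρι

/-- ★★★ **(3.24) FOR A TORUS BLOCK GIVEN BY ITS COVARIANCE, AT EVERY COUPLING `η ∈ (0,1]` — ONE-STOP** (the all-η edition of
`…ClassTorusWindowCovariance.eq324_torusCovariance_of_expDecay`, `β` quantified inside).  Class scalars `g > 0`, `Λ_G > 0`, `K_G ≥ 0`, `κ_G > 0`, label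
count `m`, the (3.24) letters ⇒ `∃ b₁ ∀ b₀ > b₁ ∃ C ≥ 0` such that for EVERY `η ∈ (0,1]`, `N`, variables `β ≠ ∅` labelled injectively by `(site, lab)`,
EVERY covariance `G` (symmetric, `g`-coercive, `Λ_G`-bounded, `|G b b′| ≤ K_G e^{−κ_Gρ}` with `ρ` dominating the torus sup-distance): a window
`Λ ⊂ ℤ^{2d+1}`, `e : β ≃ ↥Λ` presenting `𝒩(0, G)`, the a.e. box identity, and the (3.24) pair.  Proof: `exists_presentation_of_torusCovarianceDecay` ∘ seat
n08-w5's `eq324_covariance_of_expDecay_on_unit` on `ℤ^{2d+1}` at `(g, Λ_G, K_G e^{κ_G m}, κ_G/√(2d+1))`.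
[cite: Balaban1982Higgs1, (3.24) p.616; BenfattoEtAl1978, Lemma (4.5)–(4.7) p.152; Balaban1985BackgroundPropagators, (3.157)–(3.158) p.428, (3.187) p.432;
Balaban1985UV3, (58) p.270, p.261 (class form; the bent window is ours)] -/
theorem eq324_torusCovariance_of_expDecay_on_unit (hd : 0 < d) (m : ℕ) {g ΛG KG κG : ℝ} (hg0 : 0 < g) (hΛG0 : 0 < ΛG) (hKG : 0 ≤ KG)
    (hκG : 0 < κG) (t D : ℕ) {ϰ : ℝ} (hϰ : 0 < ϰ) {p₀ σ c κ : ℝ} (hp₀ : 2 / 3 < p₀) (hσ : 0 < σ) (hc : 0 ≤ c) (hκ : 0 < κ)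
    (hκσ : κ < σ * (t + 1)) :
    ∃ b₁ : ℝ, ∀ b₀ : ℝ, b₁ < b₀ → ∃ C : ℝ, 0 ≤ C ∧ ∀ η : ℝ, 0 < η → η ≤ 1 →
      ∀ {N : ℕ} [NeZero N] {β : Type} [Fintype β] [DecidableEq β] [Nonempty β]
        (site : β → Fin d → ZMod N) (lab : β → Fin m), (Function.Injective fun b => (site b, lab b)) →
      ∀ {G : Matrix β β ℝ} {ρ : β → β → ℝ}, (∀ b b', G b b' = G b' b) →
        (∀ v : β → ℝ, g * ∑ b, v b ^ 2 ≤ ∑ b, ∑ b', G b b' * v b * v b') →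
        (∀ v : β → ℝ, ∑ b, ∑ b', G b b' * v b * v b' ≤ ΛG * ∑ b, v b ^ 2) →
        (∀ b b', |G b b'| ≤ KG * Real.exp (-(κG * ρ b b'))) →
        (∀ b b' i, (|((site b i - site b' i).valMinAbs : ℤ)| : ℝ) ≤ ρ b b') →
      ∃ (Λ : Finset (B1Eq324BenfattoLemma.Site (d + d + 1))) (e : β ≃ ↥Λ),
        ((gaussianFieldOfKernel fun x y => if h : x ∈ Λ ∧ y ∈ Λ then (Matrix.reindex e e G : Matrix ↥Λ ↥Λ ℝ) ⟨x, h.1⟩ ⟨y, h.2⟩ else 0).map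
            (fun (z : B1Eq324BenfattoLemma.Site (d + d + 1) → ℝ) (b : β) => z ((e b : ↥Λ) : B1Eq324BenfattoLemma.Site (d + d + 1))) =
          gaussianFieldOfKernel fun b b' => G b b') ∧
        (∀ p : ℝ, 0 ≤ p →
          ((fun (z : B1Eq324BenfattoLemma.Site (d + d + 1) → ℝ) (b : β) => z ((e b : ↥Λ) : B1Eq324BenfattoLemma.Site (d + d + 1))) ⁻¹'
              {ω : β → ℝ | ∀ b, |ω b| ≤ p}) =ᵐ[gaussianFieldOfKernel fun x y =>
                if h : x ∈ Λ ∧ y ∈ Λ then (Matrix.reindex e e G : Matrix ↥Λ ↥Λ ℝ) ⟨x, h.1⟩ ⟨y, h.2⟩ else 0] smallFieldSet Λ p) ∧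
        ∀ (s : ℕ) (I J : Finset (B1Eq324BenfattoLemma.Site (d + d + 1))) (a : Coef (d + d + 1)), I.Nonempty → J ⊆ I → J ⊆ Λ →
          coefSup s D a J ≤ c * η ^ σ →
          0 < ∫ z, cutoffBoltzmann (hamiltonian s D ϰ a J) I (B10.pFun b₀ p₀ η) z ∂(gaussianFieldOfKernel fun x y =>
              if h : x ∈ Λ ∧ y ∈ Λ then (Matrix.reindex e e G : Matrix ↥Λ ↥Λ ℝ) ⟨x, h.1⟩ ⟨y, h.2⟩ else 0) ∧
            |Real.log (∫ z, cutoffBoltzmann (hamiltonian s D ϰ a J) I (B10.pFun b₀ p₀ η) z ∂(gaussianFieldOfKernel fun x y =>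
                if h : x ∈ Λ ∧ y ∈ Λ then (Matrix.reindex e e G : Matrix ↥Λ ↥Λ ℝ) ⟨x, h.1⟩ ⟨y, h.2⟩ else 0)) -
              cumulantSum (gaussianFieldOfKernel fun x y =>
                if h : x ∈ Λ ∧ y ∈ Λ then (Matrix.reindex e e G : Matrix ↥Λ ↥Λ ℝ) ⟨x, h.1⟩ ⟨y, h.2⟩ else 0)
                (hamiltonian s D ϰ a J) t| ≤ C * η ^ κ * I.card := by
  have hd' : 0 < d + d + 1 := by omega
  have hKG' : 0 ≤ KG * Real.exp (κG * m) := by positivity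
  have hκG' : 0 < κG / Real.sqrt (d + d + 1) := div_pos hκG (Real.sqrt_pos.mpr (by positivity))
  obtain ⟨b₁, hb₁⟩ := eq324_covariance_of_expDecay_on_unit (d := d + d + 1) hd' hg0 hΛG0 hKG' hκG' t D hϰ hp₀ hσ hc hκ hκσ
  refine ⟨b₁, fun b₀ hb₀ => ?_⟩
  obtain ⟨C, hC, hE⟩ := hb₁ b₀ hb₀
  refine ⟨C, hC, fun η hη hηle N _ β _ _ _ site lab hinj G ρ hGs hg hΛG hdec hρ => ?_⟩
  obtain ⟨Λ, e, hsymm, hcoer, hform, hdec', hmap, hbox⟩ :=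
    exists_presentation_of_torusCovarianceDecay m hd site lab hinj hGs hg0 hΛG0 hg hΛG hKG hκG.le hdec hρ
  refine ⟨Λ, e, hmap, hbox, fun s I J a hI hJI hJΛ hA => ?_⟩
  have hΛ : Λ.Nonempty := ⟨_, (e (Classical.arbitrary β)).2⟩
  exact hE η hη hηle (fun x y => rfl) hΛ hsymm hcoer hform hdec' s I J a hI hJI hJΛ hA

/-- ★★★ **(3.24) FOR `dμ_{C̃^{(k)}}` FROM NODE N06's DELIVERABLES IN THEIR OWN CURRENCY, AT EVERY COUPLING `η ∈ (0,1]`** — the Sect. E precision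
`T = C*Δ_kC` symmetric with `γ₀·‖x‖² ≤ ⟨x,Tx⟩ ≤ γ₁·‖x‖²` (p.428 «lower bound γ₀» — G-B9-09 —; [B10] p.271 «γ₁ is an upper bound») and the
(3.187)-type decay of the covariance `C̃^{(k)} = T⁻¹ = C^{(k)}(Λ)↾Λ̃` ((3.158)) along a `ρ` dominating the torus sup-distance of the free variables'
sites: class scalars `γ₀, γ₁ > 0`, `B₀ ≥ 0`, `δ₀ > 0`, label count `m` FIRST ⇒ `∃ b₁ ∀ b₀ > b₁ ∃ C ≥ 0` such that for EVERY `η ∈ (0,1]`, `N`, `β ≠ ∅`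
(sites, labels), EVERY such `T`: a window `Λ ⊂ ℤ^{2d+1}`, `e : β ≃ ↥Λ` presenting `𝒩(0, T⁻¹)`, the a.e. box identity, and the (3.24) pair.  Proof: §2
`inv_rows_of_precision_bounds` ⇒ `eq324_torusCovariance_of_expDecay_on_unit` at `(g, Λ_G) := (1/γ₁, 1/γ₀)`.
[cite: Balaban1985BackgroundPropagators, (3.157)–(3.158) p.428, Thm 3.15 (3.187) p.432; Balaban1985UV3, (58) p.270, p.271; Balaban1982Higgs1, (3.24)
p.616; BenfattoEtAl1978, Lemma (4.5)–(4.7) p.152 (class form; ours)] -/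
theorem eq324_sectECovariance_torus_on_unit (hd : 0 < d) (m : ℕ) {γ₀ γ₁ B₀ δ₀ : ℝ} (hγ₀ : 0 < γ₀) (hγ₁ : 0 < γ₁) (hB₀ : 0 ≤ B₀)
    (hδ₀ : 0 < δ₀) (t D : ℕ) {ϰ : ℝ} (hϰ : 0 < ϰ) {p₀ σ c κ : ℝ} (hp₀ : 2 / 3 < p₀) (hσ : 0 < σ) (hc : 0 ≤ c) (hκ : 0 < κ)
    (hκσ : κ < σ * (t + 1)) :
    ∃ b₁ : ℝ, ∀ b₀ : ℝ, b₁ < b₀ → ∃ C : ℝ, 0 ≤ C ∧ ∀ η : ℝ, 0 < η → η ≤ 1 →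
      ∀ {N : ℕ} [NeZero N] {β : Type} [Fintype β] [DecidableEq β] [Nonempty β]
        (site : β → Fin d → ZMod N) (lab : β → Fin m), (Function.Injective fun b => (site b, lab b)) →
      ∀ {T : Matrix β β ℝ} {ρ : β → β → ℝ}, (∀ b b', T b b' = T b' b) →
        (∀ v : β → ℝ, γ₀ * ∑ b, v b ^ 2 ≤ ∑ b, ∑ b', T b b' * v b * v b') →
        (∀ v : β → ℝ, ∑ b, ∑ b', T b b' * v b * v b' ≤ γ₁ * ∑ b, v b ^ 2) →
        (∀ b b', |(T⁻¹ : Matrix β β ℝ) b b'| ≤ B₀ * Real.exp (-(δ₀ * ρ b b'))) →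
        (∀ b b' i, (|((site b i - site b' i).valMinAbs : ℤ)| : ℝ) ≤ ρ b b') →
      ∃ (Λ : Finset (B1Eq324BenfattoLemma.Site (d + d + 1))) (e : β ≃ ↥Λ),
        ((gaussianFieldOfKernel fun x y => if h : x ∈ Λ ∧ y ∈ Λ then
            (Matrix.reindex e e (T⁻¹ : Matrix β β ℝ) : Matrix ↥Λ ↥Λ ℝ) ⟨x, h.1⟩ ⟨y, h.2⟩ else 0).map
            (fun (z : B1Eq324BenfattoLemma.Site (d + d + 1) → ℝ) (b : β) => z ((e b : ↥Λ) : B1Eq324BenfattoLemma.Site (d + d + 1))) =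
          gaussianFieldOfKernel fun b b' => (T⁻¹ : Matrix β β ℝ) b b') ∧
        (∀ p : ℝ, 0 ≤ p →
          ((fun (z : B1Eq324BenfattoLemma.Site (d + d + 1) → ℝ) (b : β) => z ((e b : ↥Λ) : B1Eq324BenfattoLemma.Site (d + d + 1))) ⁻¹'
              {ω : β → ℝ | ∀ b, |ω b| ≤ p}) =ᵐ[gaussianFieldOfKernel fun x y => if h : x ∈ Λ ∧ y ∈ Λ then
                (Matrix.reindex e e (T⁻¹ : Matrix β β ℝ) : Matrix ↥Λ ↥Λ ℝ) ⟨x, h.1⟩ ⟨y, h.2⟩ else 0] smallFieldSet Λ p) ∧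
        ∀ (s : ℕ) (I J : Finset (B1Eq324BenfattoLemma.Site (d + d + 1))) (a : Coef (d + d + 1)), I.Nonempty → J ⊆ I → J ⊆ Λ →
          coefSup s D a J ≤ c * η ^ σ →
          0 < ∫ z, cutoffBoltzmann (hamiltonian s D ϰ a J) I (B10.pFun b₀ p₀ η) z ∂(gaussianFieldOfKernel fun x y => if h : x ∈ Λ ∧ y ∈ Λ then
              (Matrix.reindex e e (T⁻¹ : Matrix β β ℝ) : Matrix ↥Λ ↥Λ ℝ) ⟨x, h.1⟩ ⟨y, h.2⟩ else 0) ∧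
            |Real.log (∫ z, cutoffBoltzmann (hamiltonian s D ϰ a J) I (B10.pFun b₀ p₀ η) z ∂(gaussianFieldOfKernel fun x y =>
                if h : x ∈ Λ ∧ y ∈ Λ then (Matrix.reindex e e (T⁻¹ : Matrix β β ℝ) : Matrix ↥Λ ↥Λ ℝ) ⟨x, h.1⟩ ⟨y, h.2⟩ else 0)) -
              cumulantSum (gaussianFieldOfKernel fun x y => if h : x ∈ Λ ∧ y ∈ Λ then
                  (Matrix.reindex e e (T⁻¹ : Matrix β β ℝ) : Matrix ↥Λ ↥Λ ℝ) ⟨x, h.1⟩ ⟨y, h.2⟩ else 0)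
                (hamiltonian s D ϰ a J) t| ≤ C * η ^ κ * I.card := by
  obtain ⟨b₁, hb₁⟩ := eq324_torusCovariance_of_expDecay_on_unit (d := d) hd m (g := 1 / γ₁) (ΛG := 1 / γ₀)
    (one_div_pos.mpr hγ₁) (one_div_pos.mpr hγ₀) hB₀ hδ₀ t D hϰ hp₀ hσ hc hκ hκσ
  refine ⟨b₁, fun b₀ hb₀ => ?_⟩
  obtain ⟨C, hC, hE⟩ := hb₁ b₀ hb₀
  refine ⟨C, hC, fun η hη hηle N _ β _ _ _ site lab hinj T ρ hTs hlow hup hGdec hρ => ?_⟩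
  obtain ⟨hGs, hg, hΛG⟩ := inv_rows_of_precision_bounds hTs hγ₀ hlow hup
  exact hE η hη hηle site lab hinj hGs hg hΛG hGdec hρ


/-! ## §4  The same with `γ₀` derived from the written γ₀-assembly interface of cell pub-balaban (`B9SectEKernel.gamma0_assembly`) -/

/-- ★★★ **(3.24) FOR `dμ_{C̃^{(k)}}` WITH `γ₀` SUPPLIED IN THE SHAPE OF THE WRITTEN γ₀-ASSEMBLY** (cell pub-balaban's `B9SectEKernel.gamma0_assembly`,
the logic of p.428's claim: `S = G₁⁻¹ = K + aQ*Q`, `P = (QG₁Q*)⁻¹` characterised inverse-free by `QH = 1`, `SH = QᵀP`; (h1) a covariant-Stokes-type bound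
`F(QA) ≤ κ₁⟨A,KA⟩ + κ₂‖QA‖²`, (h2) a covariant Lemma-2.4′-type bound `c₂‖B‖² ≤ F(B)` on the admissible subspace `good`, (hJ) `|⟨B,𝒥B⟩| ≤ θ‖B‖²`;
the elimination matrix maps into `good` and does not decrease norms).  With the class scalar `γ₀ ≤ (c₂ − κ₂)/κ₁ − θ` FIXED FIRST and the rest as in
`eq324_sectEPrecision_torus_on_unit`: the same conclusion, the `γ₀`-coercivity of `Eᵀ(P − a·1 − 𝒥)E` being DERIVED (`gamma0_assembly` ∘
`sandwich_coercive_sum`) instead of displayed.  The analytic inputs (h1), (h2), (hJ) and (3.132) are node N06's ([B9] Thms 3.3∕3.11∕3.12, (3.36),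
[Balaban1984PropagatorsII] Lemma 2.4) — DISPLAYED, not proved.
[cite: Balaban1985BackgroundPropagators, Sect. E p.428 (γ₀ claim, G-B9-09), (3.155)–(3.158); Balaban1984PropagatorsII, Lemma 2.4 p.233, p.250;
Balaban1985UV3, (58) p.270, p.271; Balaban1982Higgs1, (3.24) p.616; BenfattoEtAl1978, Lemma (4.5)–(4.7) p.152 (class form; ours)] -/
theorem eq324_sectEPrecision_torus_of_gamma0Assembly_on_unit (hd : 0 < d) (m : ℕ) {γ₀ KP KJ a₀ δ r mC : ℝ} (hγ₀ : 0 < γ₀) (hKP : 0 ≤ KP) (hKJ : 0 ≤ KJ)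
    (ha₀ : 0 ≤ a₀) (hδ : 0 < δ) (hmC : 0 ≤ mC)
    (t D : ℕ) {ϰ : ℝ} (hϰ : 0 < ϰ) {p₀ σ c κ : ℝ} (hp₀ : 2 / 3 < p₀) (hσ : 0 < σ) (hc : 0 ≤ c) (hκ : 0 < κ)
    (hκσ : κ < σ * (t + 1)) :
    ∃ b₁ : ℝ, ∀ b₀ : ℝ, b₁ < b₀ → ∃ C : ℝ, 0 ≤ C ∧ ∀ η : ℝ, 0 < η → η ≤ 1 →
      ∀ {N : ℕ} [NeZero N] {ν υ β : Type} [Fintype ν] [Fintype υ] [DecidableEq υ] [Fintype β] [DecidableEq β] [Nonempty β]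
        (ρ : υ → υ → ℝ), IsPseudoDist ρ →
      ∀ (site : β → Fin d → ZMod N) (lab : β → Fin m), (Function.Injective fun b => (site b, lab b)) →
      ∀ (ι : β → υ), (∀ b b' i, (|((site b i - site b' i).valMinAbs : ℤ)| : ℝ) ≤ ρ (ι b) (ι b')) →
      ∀ {Kf : Matrix ν ν ℝ} {Q : Matrix υ ν ℝ} {H : Matrix ν υ ℝ} {P J : Matrix υ υ ℝ} {a : ℝ} {E : Matrix υ β ℝ}
        {good : (υ → ℝ) → Prop} {F : (υ → ℝ) → ℝ} {κ₁ κ₂ c₂ θ : ℝ},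
        Q * H = 1 → (Kf + a • (Qᵀ * Q)) * H = Qᵀ * P → 0 < κ₁ →
        (∀ A : ν → ℝ, F (Q *ᵥ A) ≤ κ₁ * (A ⬝ᵥ (Kf *ᵥ A)) + κ₂ * ((Q *ᵥ A) ⬝ᵥ (Q *ᵥ A))) →
        (∀ B : υ → ℝ, good B → c₂ * (B ⬝ᵥ B) ≤ F B) → (∀ B : υ → ℝ, |B ⬝ᵥ (J *ᵥ B)| ≤ θ * (B ⬝ᵥ B)) →
        γ₀ ≤ (c₂ - κ₂) / κ₁ - θ →
        (∀ v : β → ℝ, good (E *ᵥ v)) → (∀ v : β → ℝ, v ⬝ᵥ v ≤ (E *ᵥ v) ⬝ᵥ (E *ᵥ v)) →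
        (∀ u v, P u v = P v u) → (∀ u v, J u v = J v u) →
        (∀ u v, |P u v| ≤ KP * Real.exp (-(δ * ρ u v))) → (∀ u v, |J u v| ≤ KJ * Real.exp (-(δ * ρ u v))) → |a| ≤ a₀ →
        (∀ u b, E u b ≠ 0 → ρ u (ι b) ≤ r) → (∀ b, ∑ u, |E u b| ≤ mC) →
      ∃ (Λ : Finset (B1Eq324BenfattoLemma.Site (d + d + 1))) (e : β ≃ ↥Λ),
        ((gaussianFieldOfKernel fun x y => if h : x ∈ Λ ∧ y ∈ Λ then
            ((Matrix.reindex e e (Eᵀ * (P - a • (1 : Matrix υ υ ℝ) - J) * E))⁻¹ : Matrix ↥Λ ↥Λ ℝ) ⟨x, h.1⟩ ⟨y, h.2⟩ else 0).map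
            (fun (z : B1Eq324BenfattoLemma.Site (d + d + 1) → ℝ) (b : β) => z ((e b : ↥Λ) : B1Eq324BenfattoLemma.Site (d + d + 1))) =
          gaussianFieldOfKernel fun b b' => ((Eᵀ * (P - a • (1 : Matrix υ υ ℝ) - J) * E)⁻¹ : Matrix β β ℝ) b b') ∧
        (∀ p : ℝ, 0 ≤ p →
          ((fun (z : B1Eq324BenfattoLemma.Site (d + d + 1) → ℝ) (b : β) => z ((e b : ↥Λ) : B1Eq324BenfattoLemma.Site (d + d + 1))) ⁻¹'
              {ω : β → ℝ | ∀ b, |ω b| ≤ p}) =ᵐ[gaussianFieldOfKernel fun x y => if h : x ∈ Λ ∧ y ∈ Λ then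
                ((Matrix.reindex e e (Eᵀ * (P - a • (1 : Matrix υ υ ℝ) - J) * E))⁻¹ : Matrix ↥Λ ↥Λ ℝ) ⟨x, h.1⟩ ⟨y, h.2⟩ else 0]
            smallFieldSet Λ p) ∧
        ∀ (s : ℕ) (I J' : Finset (B1Eq324BenfattoLemma.Site (d + d + 1))) (𝔞 : Coef (d + d + 1)), I.Nonempty → J' ⊆ I → J' ⊆ Λ →
          coefSup s D 𝔞 J' ≤ c * η ^ σ →
          0 < ∫ z, cutoffBoltzmann (hamiltonian s D ϰ 𝔞 J') I (B10.pFun b₀ p₀ η) z ∂(gaussianFieldOfKernel fun x y => if h : x ∈ Λ ∧ y ∈ Λ then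
              ((Matrix.reindex e e (Eᵀ * (P - a • (1 : Matrix υ υ ℝ) - J) * E))⁻¹ : Matrix ↥Λ ↥Λ ℝ) ⟨x, h.1⟩ ⟨y, h.2⟩ else 0) ∧
            |Real.log (∫ z, cutoffBoltzmann (hamiltonian s D ϰ 𝔞 J') I (B10.pFun b₀ p₀ η) z ∂(gaussianFieldOfKernel fun x y =>
                if h : x ∈ Λ ∧ y ∈ Λ then
                  ((Matrix.reindex e e (Eᵀ * (P - a • (1 : Matrix υ υ ℝ) - J) * E))⁻¹ : Matrix ↥Λ ↥Λ ℝ) ⟨x, h.1⟩ ⟨y, h.2⟩ else 0)) -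
              cumulantSum (gaussianFieldOfKernel fun x y => if h : x ∈ Λ ∧ y ∈ Λ then
                  ((Matrix.reindex e e (Eᵀ * (P - a • (1 : Matrix υ υ ℝ) - J) * E))⁻¹ : Matrix ↥Λ ↥Λ ℝ) ⟨x, h.1⟩ ⟨y, h.2⟩ else 0)
                (hamiltonian s D ϰ 𝔞 J') t| ≤ C * η ^ κ * I.card := by
  obtain ⟨b₁, hb₁⟩ := eq324_sectEPrecision_torus_on_unit (d := d) hd m hγ₀ hKP hKJ ha₀ hδ hmC t D hϰ hp₀ hσ hc hκ hκσ
  refine ⟨b₁, fun b₀ hb₀ => ?_⟩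
  obtain ⟨C, hC, hE⟩ := hb₁ b₀ hb₀
  refine ⟨C, hC, fun η hη hηle N _ ν υ β _ _ _ _ _ _ ρ hρ site lab hinj ι hρι Kf Q H P J a E good F κ₁ κ₂ c₂ θ hQH hSH hκ₁ h1 h2 hJθ hγle
    hgood hEn hPs hJs hP hJ ha hCr hC1 => ?_⟩
  -- γ₀ from the assembly, through the sandwich door, weakened to the class scalar
  have hT : ∀ B : υ → ℝ, good B → ((c₂ - κ₂) / κ₁ - θ) * (B ⬝ᵥ B) ≤ B ⬝ᵥ ((P - a • (1 : Matrix υ υ ℝ) - J) *ᵥ B) :=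
    fun B hB => B9SectEKernel.gamma0_assembly Kf Q a H P J hQH hSH good F hκ₁ h1 h2 hJθ B hB
  have hγ : ∀ v : β → ℝ, γ₀ * ∑ b, v b ^ 2 ≤ ∑ b, ∑ b', (Eᵀ * (P - a • (1 : Matrix υ υ ℝ) - J) * E) b b' * v b * v b' := by
    intro v
    have h := sandwich_coercive_sum (P - a • (1 : Matrix υ υ ℝ) - J) E good (hγ₀.le.trans hγle) hgood hEn hT v
    exact (mul_le_mul_of_nonneg_right hγle (Finset.sum_nonneg fun b _ => sq_nonneg (v b))).trans h
  exact hE η hη hηle ρ hρ site lab hinj ι hρι hPs hJs hP hJ ha hCr hC1 hγ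

/-- Non-vacuity of the scalar side of `eq324_sectEPrecision_torus_on_unit` (the binder list elaborates end to end): `d = 3`, label count
`m = 24` (3 bond directions × 8 colours of `su(3)`), `γ₀ = 1`, `K_P = K_𝒥 = a₀ = 1`, `δ = 1`, `r = 2`, `m_C = 9`, and the (α)-socket's letters
`t = 6`, `D = 4`, `ϰ = 1`, `p₀ = 1`, `σ = 1/2`, `c = 1`, `κ = 13/4 < σ(t+1) = 7/2`. [cite: Balaban1985UV3, (24) p.262 (letters of the socket; instance ours)] -/
example :=
  eq324_sectEPrecision_torus_on_unit (d := 3) (by norm_num) 24 (γ₀ := 1) (KP := 1) (KJ := 1) (a₀ := 1) (δ := 1) (r := 2) (mC := 9)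
    one_pos zero_le_one zero_le_one zero_le_one one_pos (by norm_num) 6 4 (ϰ := 1) one_pos (p₀ := 1) (σ := 1 / 2) (c := 1) (κ := 13 / 4)
    (by norm_num) (by norm_num) zero_le_one (by norm_num) (by norm_num)

/-- Non-vacuity of the scalar side of `eq324_sectECovariance_torus_on_unit`: `d = 3`, `m = 24`, `γ₀ = 1`, `γ₁ = 5`, `B₀ = 2`, `δ₀ = 1/3`, socket
letters as above. [cite: Balaban1985UV3, (58) p.270, p.271 (letters; instance ours)] -/
example :=
  eq324_sectECovariance_torus_on_unit (d := 3) (by norm_num) 24 (γ₀ := 1) (γ₁ := 5) (B₀ := 2) (δ₀ := 1 / 3)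
    one_pos (by norm_num) (by norm_num) (by norm_num) 6 4 (ϰ := 1) one_pos (p₀ := 1) (σ := 1 / 2) (c := 1) (κ := 13 / 4)
    (by norm_num) (by norm_num) zero_le_one (by norm_num) (by norm_num)

end Torus

end Literature.MathematicalPhysics.QuantumFieldTheory.Balaban1983to89.B1Eq324BenfattoClassSectEMember

end
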